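import Literature.NumberTheory.Automorphic.UnboundedDenominators

/-!
# The unbounded denominators theorem (Calegari–Dimitrov–Tang) — Theorem 4.3.2: the degree doubling, field-theoretic skeleton

Eighth sibling of `Literature/NumberTheory/Automorphic/UnboundedDenominators.lean`. Sorry-free
theorems only; NO definition, NO named fact (D-0026). Source: F. Calegari, V. Dimitrov, Y. Tang,
*The unbounded denominators conjecture*, J. Amer. Math. Soc. **38** (2025), 627–702 =
arXiv:2109.09040v4, §4.3, Theorem 4.3.2 and its proof (published numbering; arXiv v1 Theorem 25).

CDT Theorem 4.3.2: if `[R_N : M_N] > 1` then `[R_{Np} : M_{Np}] ≥ 2 [R_N : M_N]` for every prime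
`p ∤ N`. Its proof is Theorem 4.3.1 (`f(pτ) ∉ R_N M_{Np}`, group theory — see the sibling files
`UnboundedDenominators{Leveraging,SerreBerger,BorelFactor,IharaEnhanced}Proofs.lean`) plus the
degree computation
`[R_{Np} : M_N] = [R_{Np} : R_N M_{Np}] · [R_N : M_N] · [M_{Np} : M_N]` ("because the intersection
of `M_{Np}` and `R_N` is `M_N`"), i.e. the linear disjointness of `R_N` and `M_{Np}` over `M_N`. The
spaces `R_N`, `M_N` (Definition 4.2.1) are not yet in the tree; this file records the field theory
ABSTRACTLY, ready to be instantiated by that instalment: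

* `CalegariDimitrovTang2025_unboundedDenominators.two_mul_finrank_le_of_inf_eq_bot_of_sup_ne_top` —
  for a finite extension `E/F` and intermediate fields `A`, `B` with `A/F` Galois, `A ⊓ B = ⊥` and
  `A ⊔ B ≠ ⊤`: `2 · [B : F] ≤ [E : A]`. Dictionary: `F = M_N`, `A = M_{Np}` (the function field of
  `Y(Np)` over that of `Y(N)`, Galois), `B = R_N`, `E = R_{Np}`; `A ⊓ B = ⊥` is "`M_{Np} ∩ R_N = M_N`";
  `A ⊔ B ≠ ⊤` is Theorem 4.3.1 (`f(pτ) ∈ R_{Np} ∖ R_N M_{Np}`); the conclusion is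
  `[R_{Np} : M_{Np}] ≥ 2 [R_N : M_N]`, the hypothesis `hdouble` of the tree's
  `CalegariDimitrovTang2025_unboundedDenominators.le_one_of_log_bound_of_doubling`
  (Proposition 4.3.5 skeleton). Linear disjointness comes from Mathlib's
  `IntermediateField.LinearDisjoint.of_inf_eq_bot` (Galois case) — CDT use the intersection
  condition; the Galois hypothesis on `M_{Np}/M_N` is what makes it sufficient.
* `CalegariDimitrovTang2025_unboundedDenominators.finrank_eq_mul_mul_of_inf_eq_bot` — the displayed
  degree identity `[E : F] = [E : A ⊔ B] · [B : F] · [A : F]` itself.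

## References

* [CalegariDimitrovTang2025] F. Calegari, V. Dimitrov, Y. Tang, The unbounded denominators
  conjecture, J. Amer. Math. Soc. 38 (2025), 627–702; arXiv:2109.09040. §4.3, Theorem 4.3.2.
-/

namespace Literature.NumberTheory.Automorphic

open Module

/-- **The degree identity in the proof of CDT Theorem 4.3.2** [cite: CalegariDimitrovTang2025,
Theorem 4.3.2 (proof)]: for a finite extension `E/F` and intermediate fields `A`, `B` with `A/F`
Galois and `A ⊓ B = ⊥` ("the intersection of `M_{Np}` and `R_N` is `M_N`"),
`[E : F] = [A : F] · [B : F] · [E : A ⊔ B]` — i.e. "`[R_{Np} : M_N] = [R_{Np} : R_N M_{Np}] ·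
[R_N : M_N] · [M_{Np} : M_N]`" (linear disjointness of `A`, `B` over `F`, Mathlib
`IntermediateField.LinearDisjoint.of_inf_eq_bot`, and the tower law). -/
theorem CalegariDimitrovTang2025_unboundedDenominators.finrank_eq_mul_mul_of_inf_eq_bot
    {F E : Type*} [Field F] [Field E] [Algebra F E] [FiniteDimensional F E]
    (A B : IntermediateField F E) [IsGalois F A] (hAB : A ⊓ B = ⊥) :
    finrank F E = finrank F A * finrank F B * finrank ↥(A ⊔ B) E := by
  have hdisj : A.LinearDisjoint B := IntermediateField.LinearDisjoint.of_inf_eq_bot hAB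
  rw [← hdisj.finrank_sup, Module.finrank_mul_finrank]

/-- **CDT Theorem 4.3.2, field-theoretic skeleton** [cite: CalegariDimitrovTang2025, Theorem 4.3.2]:
for a finite extension `E/F` and intermediate fields `A`, `B` with `A/F` Galois, `A ⊓ B = ⊥` and
`A ⊔ B ≠ ⊤`, one has `2 · [B : F] ≤ [E : A]`. With `F = M_N`, `A = M_{Np}`, `B = R_N`,
`E = R_{Np}`: "`[R_{Np} : M_{Np}] / [R_N : M_N] = [R_{Np} : R_N M_{Np}]` is an integer which is
`≥ 2`" as soon as `R_N M_{Np} ≠ R_{Np}`, which is Theorem 4.3.1 (`f(pτ) ∉ R_N M_{Np}`). The output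
is the doubling hypothesis of the tree's Proposition 4.3.5 skeleton
`CalegariDimitrovTang2025_unboundedDenominators.le_one_of_log_bound_of_doubling`. -/
theorem CalegariDimitrovTang2025_unboundedDenominators.two_mul_finrank_le_of_inf_eq_bot_of_sup_ne_top
    {F E : Type*} [Field F] [Field E] [Algebra F E] [FiniteDimensional F E]
    (A B : IntermediateField F E) [IsGalois F A] (hAB : A ⊓ B = ⊥) (hne : A ⊔ B ≠ ⊤) :
    2 * finrank F B ≤ finrank A E := by
  have h := CalegariDimitrovTang2025_unboundedDenominators.finrank_eq_mul_mul_of_inf_eq_bot A B hAB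
  have ht : finrank F A * finrank A E = finrank F E := Module.finrank_mul_finrank F A E
  -- `[E : A ⊔ B] ≥ 2` since `A ⊔ B ≠ E`
  have h2 : 2 ≤ finrank ↥(A ⊔ B) E := by
    by_contra hlt
    have hpos : 0 < finrank ↥(A ⊔ B) E := Module.finrank_pos
    have h1 : finrank ↥(A ⊔ B) E = 1 := by omega
    apply hne
    rw [eq_top_iff]
    intro x _
    obtain ⟨c, hc⟩ := (finrank_eq_one_iff_of_nonzero' (1 : E) one_ne_zero).mp h1 x
    rw [← hc, Algebra.smul_def, mul_one]
    exact c.2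
  have hApos : 0 < finrank F A := Module.finrank_pos
  have hle : finrank F A * (2 * finrank F B) ≤ finrank F A * finrank A E := by
    rw [ht, h]
    calc finrank F A * (2 * finrank F B) = finrank F A * finrank F B * 2 := by ring
      _ ≤ finrank F A * finrank F B * finrank ↥(A ⊔ B) E := Nat.mul_le_mul_left _ h2
  exact Nat.le_of_mul_le_mul_left hle hApos

end Literature.NumberTheory.Automorphic
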